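import Literature.AlgebraicGeometry.Resolution.WeightedCentreTheoremAPlus
import Literature.AlgebraicGeometry.Resolution.WeightedCentreBottomOne
import HarnessLib

/-!
# Weighted centres — THEOREM A⁺ for a LIGHT bottom class (`1 ≤ w(L₁) ≤ p − 1`), positive form

Instrument for engine 1's `W(f)` TOY MODEL (cell `pub-rosobs`, LF-MODEL-eng1-g45 §6.2 THEOREM A⁺: "every `X ∈ Iso(N, g)` fixes every slot of `L₁`" for a light bottom class),
NOT a resolution theorem and NOT about the invariant of [AbramovichTemkinWlodarczyk2024].

`apply_CX_eq_of_slotPinned` joins `false_of_moves_bottom_one` (`r = 1`, ND0) and `false_of_moves_bottom` (`2 ≤ r ≤ p − 1`): a graded `k[σ]`-automorphism `X₀ ≡ id (mod σ)` fixing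
the heavy slots `ε_V` and `g` FIXES every (P)-pinned slot `z` of minimal weight `w z = r ∈ {1, …, p − 1}`.  (P) enters slot-wise as `Truncation.SlotPinned w z g`; the passage
from the engine's class-level (P) at `L₁` to the moved slot (a permutation of equal-weight slots is a graded automorphism pair) is left to the assembly of the REDUCTION.

References: [Lang2002, Ch. IV §1, Ch. V §5, Ch. XIII §4]; [Matsumura1987, §27]; [AbramovichTemkinWlodarczyk2024, §5.1 (p. 1575), Thm. 5.3.1 (2)–(3) (p. 1578)].
-/

namespace Literature.AlgebraicGeometry.Resolution.WeightedBlowup.BottomClimb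

open Polynomial OrderFiltration LevelProjection ZKernel Truncation

variable {k : Type*} [Field k] {ι : Type*} [Fintype ι] [DecidableEq ι] {w : ι → ℚ} {p : ℕ} [Fact p.Prime] [CharP k p] {u : ℕ → k}

/-- **THEOREM A⁺ (light bottom class, positive form)** — LF-MODEL-eng1-g45 §6.2: weights `≥ 0`, every slot of weight `> p + 1` in `V`, `b!·u_b = 1 (b < p)`; a graded
`k[σ]`-automorphism `X₀ ≡ id (mod σ)` fixing `ε_V` and `g` fixes every slot `z` of minimal weight `w z = r`, `1 ≤ r ≤ p − 1`, at which `g` is (P)-pinned.  Instrument for engine 1's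
`W(f)` toy model, NOT a resolution theorem. [cite: AbramovichTemkinWlodarczyk2024, §5.1 (p. 1575), Thm. 5.3.1 (2)–(3) (p. 1578); Lang2002, Ch. IV §1, Ch. XIII §4; Matsumura1987, §27] -/
theorem apply_CX_eq_of_slotPinned (hu : ∀ n < p, (Nat.factorial n : k) * u n = 1) (hw : ∀ i, 0 ≤ w i) {V : Set ι}
    (hVw : ∀ i, w i ≤ (p : ℚ) + 1 ∨ i ∈ V) {X₀ : (MvPolynomial ι k)[X] ≃+* (MvPolynomial ι k)[X]} (hg : X₀ ∈ graded w (1 : ℚ))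
    (hb : X₀ ∈ baseFixing) (h1 : X₀ ∈ level (X : (MvPolynomial ι k)[X]) 1) (hV : X₀ ∈ fixSlots V) {g : MvPolynomial ι k}
    (hfix : X₀ (C g) = C g) {z : ι} (hmin : ∀ j, w z ≤ w j) {r : ℕ} (hwz : w z = r) (hr1 : 1 ≤ r) (hrp : r ≤ p - 1)
    (hP : SlotPinned w z g) : X₀ (C (MvPolynomial.X z)) = C (MvPolynomial.X z) := by
  by_contra hmove
  rcases Nat.lt_or_ge r 2 with hr | hr
  · have hr' : r = 1 := by omega
    subst hr'
    exact false_of_moves_bottom_one hw hg hb h1 hfix hmin (by rw [hwz, Nat.cast_one]) hmove hP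
  · exact false_of_moves_bottom hu hw hVw hg hb h1 hV hfix hmin hwz hr hrp hmove hP

end Literature.AlgebraicGeometry.Resolution.WeightedBlowup.BottomClimb
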